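import Mathlib
import HarnessLib
import Literature.Analysis.PDE.DivFormStrongMaximumPrinciple
import Literature.Analysis.FunctionSpaces.BombieriGiustiLemma
import Summits.NavierStokesRegularity.NavierStokesRegularity.Theorems.PoloidalWindowDoorPoloidalWindowRigidityDivFormLocalHarnackInputs

/-!
# Route `PoloidalWindowDoor`, crux K2 (stmt-NavierStokesRegularity-19708) — the INTERIOR HARNACK INEQUALITY for LOCAL
# weak solutions of `div(a∇w) = 0`, `n ≥ 3` (Moser 1961 Thm 1 / Gilbarg–Trudinger Thm 8.20, localised; towards
# `divFormStrongMaximumPrinciple_holds`, GT 8.19)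

`harnack_local`: there is `C_H = C_H(n, λ, Λ)` such that for every coefficient field `a` (measurable, symmetric,
`λ|ξ|² ≤ ξ·aξ`, `|aᵢⱼ| ≤ Λ`), every open `U`, every `C¹` function `w ≥ 1` solving `div(a∇w) = 0` weakly against the
test functions supported in `U` (the hypothesis of `Literature.Analysis.PDE.divFormStrongMaximumPrinciple`), and every
ball with `B̄(x₀,4R) ⊆ U`:  `w(x) ≤ C_H · w(y)` for all `x, y ∈ B̄(x₀,R)`.

Proof (Moser 1971 / Bombieri–Giusti, no `BMO`): apply `Literature.Analysis.FunctionSpaces.bombieriGiusti` on the balls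
`S θ = B̄(x₀,2θR)` to `f₁ = e^{−c} w` and `f₂ = e^{c}/w`, `c = (log w)_{B(x₀,2R)}`: hypothesis (A) is
`…LocalHarnackInputs.local_log_levelset` (Poincaré–Wirtinger + logarithmic Caccioppoli), hypothesis (B) is
`…LocalHarnackInputs.local_sup_bound` (the local Moser chains, `σ = ±1`, at the log-dense admissible exponents of
`exists_chain_exponent_between`).  Then `log w − c ≤ A₀` and `c − log w ≤ A₀` on `B̄(x₀,R)`, i.e. `C_H = e^{2A₀}`.

Seat ns-in-ser-b g5 (cell pub/ns-inputs), `ledger fact claim` #1 on `Literature.Analysis.PDE.divFormStrongMaximumPrinciple`.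
WHAT THIS IS NOT: not yet the strong maximum principle (sequel: globalisation of a local solution, clopen argument,
descent to `n ≤ 2`); nothing NS-specific, no NS statement is touched.
-/

noncomputable section

open MeasureTheory Set Function Filter Topology Metric Module
open scoped Matrix ENNReal NNReal

-- the summit and its single sub-problem share the name (CONVENTIONS §1), as in every Theorems file
set_option linter.dupNamespace false

namespace Summit.NavierStokesRegularity.NavierStokesRegularity.Theorems.PoloidalWindowDoorPoloidalWindowRigidityDivFormLocalHarnack

open Summit.NavierStokesRegularity.NavierStokesRegularity.Theorems.PoloidalWindowDoorPoloidalWindowRigidityDivFormCaccioppoli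
open Summit.NavierStokesRegularity.NavierStokesRegularity.Theorems.PoloidalWindowDoorPoloidalWindowRigidityDivFormReverseHolder
open Summit.NavierStokesRegularity.NavierStokesRegularity.Theorems.PoloidalWindowDoorPoloidalWindowRigidityDivFormMoserStep
open Summit.NavierStokesRegularity.NavierStokesRegularity.Theorems.PoloidalWindowDoorPoloidalWindowRigidityDivFormLogBMO
open Summit.NavierStokesRegularity.NavierStokesRegularity.Theorems.PoloidalWindowDoorPoloidalWindowRigidityDivFormLocalHarnackInputs
open Literature.Analysis.FunctionSpaces

variable {n : ℕ}

/-- **INTERIOR HARNACK INEQUALITY for local weak solutions** (Moser 1961, Thm 1; Gilbarg–Trudinger Thm 8.20 — here for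
`C¹` weak solutions and via Moser 1971 / Bombieri–Giusti instead of John–Nirenberg), `n ≥ 3`: there is
`C_H = C_H(n,λ,Λ) ≥ 0` such that for every admissible coefficient field `a`, every set `U`, every `C¹` function `w ≥ 1`
with `∫ Σ aᵢⱼ ∂ᵢw ∂ⱼη = 0` for all `η ∈ C¹_c` with `tsupport η ⊆ U`, and every ball with `B̄(x₀,4R) ⊆ U`, `R > 0`:
`w x ≤ C_H · w y` for all `x, y ∈ B̄(x₀,R)`. -/
theorem harnack_local (hn : 3 ≤ n) {lam : ℝ} (hlam : 0 < lam) (Λ : ℝ) :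
    ∃ C_H : ℝ, 0 ≤ C_H ∧ ∀ (a : EuclideanSpace ℝ (Fin n) → Matrix (Fin n) (Fin n) ℝ),
      (∀ i j, Measurable fun y => a y i j) → (∀ y, (a y).IsSymm) →
      (∀ y (ξ : Fin n → ℝ), lam * (ξ ⬝ᵥ ξ) ≤ ξ ⬝ᵥ (a y *ᵥ ξ)) → (∀ y i j, |a y i j| ≤ Λ) →
      ∀ (U : Set (EuclideanSpace ℝ (Fin n))) (w : EuclideanSpace ℝ (Fin n) → ℝ), ContDiff ℝ 1 w → (∀ y, 1 ≤ w y) →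
        (∀ η : EuclideanSpace ℝ (Fin n) → ℝ, ContDiff ℝ 1 η → HasCompactSupport η → tsupport η ⊆ U →
          ∫ y, ∑ i, ∑ j, a y i j * fderiv ℝ w y (EuclideanSpace.single i 1) *
            fderiv ℝ η y (EuclideanSpace.single j 1) = 0) →
        ∀ (x₀ : EuclideanSpace ℝ (Fin n)) (R : ℝ), 0 < R → closedBall x₀ (4 * R) ⊆ U →
          ∀ x ∈ closedBall x₀ R, ∀ y ∈ closedBall x₀ R, w x ≤ C_H * w y := by
  -- structural constants
  set κ : ℝ := n / (n - 2 : ℝ) with hκ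
  have hn2 : (0 : ℝ) < n - 2 := by
    have : (3 : ℝ) ≤ n := by exact_mod_cast hn
    linarith
  have hnpos : (0 : ℝ) < n := by linarith
  have hκ1 : 1 < κ := by rw [hκ, lt_div_iff₀ hn2]; linarith
  have hκ0 : 0 < κ := zero_lt_one.trans hκ1
  obtain ⟨C₀c, hC₀c0, hcutc⟩ := exists_closedBall_cutoff n
  obtain ⟨C₀b, -, hcutb⟩ := exists_ball_cutoff n
  set C₁c : ℝ := C₀c + 1 with hC₁c
  have hC₁cpos : 0 < C₁c := by rw [hC₁c]; linarith
  have hcut' : ∀ (x₀ : EuclideanSpace ℝ (Fin n)) (ρ' ρ : ℝ), 0 < ρ' → ρ' < ρ →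
      ∃ χ : EuclideanSpace ℝ (Fin n) → ℝ, ContDiff ℝ 1 χ ∧ HasCompactSupport χ ∧ (∀ x, 0 ≤ χ x ∧ χ x ≤ 1) ∧
        (∀ x ∈ closedBall x₀ ρ', χ x = 1) ∧ (∀ x, x ∉ ball x₀ ρ → χ x = 0) ∧
        ∀ x, ‖fderiv ℝ χ x‖ ≤ C₁c / (ρ - ρ') := by
    intro x₀ ρ' ρ hρ' hρ
    obtain ⟨χ, h1, h2, h3, h4, h5, h6⟩ := hcutc x₀ ρ' ρ hρ' hρ
    refine ⟨χ, h1, h2, h3, h4, h5, fun x => (h6 x).trans ?_⟩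
    exact div_le_div_of_nonneg_right (by rw [hC₁c]; linarith) (by linarith)
  set D₁ : ℝ := (Real.sqrt κ / (Real.sqrt κ - 1)) ^ 2 with hD₁
  set CS : ℝ := max (eLpNormLESNormFDerivOfEqInnerConst (volume : Measure (EuclideanSpace ℝ (Fin n))) 2 : ℝ) 1 with hCS
  set V₀r : ℝ := (volume (ball (0 : EuclideanSpace ℝ (Fin n)) 1)).toReal with hV₀r
  set e₂ : ℝ := κ / (κ - 1) ^ 2 with he₂
  set C₁p : ℝ := max 1 ((CS ^ 2 * (2 * (D₁ * (n * Λ) + lam) / lam * (4 * C₁c ^ 2))) ^ ((n : ℝ) / 2) *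
    (4 : ℝ) ^ e₂ * V₀r) with hC₁p
  set C₁m : ℝ := max 1 ((CS ^ 2 * (2 * (1 * (n * Λ) + lam) / lam * (4 * C₁c ^ 2))) ^ ((n : ℝ) / 2) *
    (4 : ℝ) ^ e₂ * V₀r) with hC₁m
  set C₁ : ℝ := max C₁p C₁m with hC₁
  have hC₁1 : 1 ≤ C₁ := (le_max_left _ _).trans (le_max_left _ _)
  set C_A : ℝ := 16 * 4 ^ n * (n * Λ) * C₀b ^ 2 / lam + 1 with hC_A
  set C₀g : ℝ := max C_A 1 with hC₀g
  have hC₀gpos : 0 < C₀g := lt_of_lt_of_le one_pos (le_max_right _ _)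
  set A₀ : ℝ := 4 * C₀g * (2 * C₁) ^ (2 * κ) * 4 ^ ((n : ℝ) * κ) * (16 * ((n : ℝ) * κ)) ^ (4 * ((n : ℝ) * κ))
    with hA₀
  refine ⟨Real.exp (2 * A₀), (Real.exp_pos _).le,
    fun a hmeas hsymm hell hbd U w hw hw1 hweak x₀ R hR hU x hx y hy => ?_⟩
  -- inside: positivity and the two balls
  have hpos : ∀ z, 0 < w z := fun z => lt_of_lt_of_le one_pos (hw1 z)
  have hU2 : closedBall x₀ (2 * R) ⊆ U := (closedBall_subset_closedBall (by linarith)).trans hU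
  -- Bombieri–Giusti data: the balls `S θ = B̄(x₀, 2θR)`
  set S : ℝ → Set (EuclideanSpace ℝ (Fin n)) := fun θ => closedBall x₀ (2 * θ * R) with hSdef
  have hS : ∀ ⦃θ' θ : ℝ⦄, θ' ≤ θ → S θ' ⊆ S θ := fun θ' θ h =>
    closedBall_subset_closedBall (by nlinarith)
  have hSm : ∀ θ, MeasurableSet (S θ) := fun θ => measurableSet_closedBall
  have hS1 : S 1 = closedBall x₀ (2 * R) := by simp only [hSdef]; ring_nf
  have hShalf : S (1 / 2) = closedBall x₀ R := by simp only [hSdef]; ring_nf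
  have hV0 : volume (S 1) ≠ 0 := by rw [hS1]; exact (measure_closedBall_pos volume x₀ (by positivity)).ne'
  have hVt : volume (S 1) ≠ ⊤ := by rw [hS1]; exact measure_closedBall_lt_top.ne
  -- the two functions
  set c : ℝ := ⨍ z in ball x₀ (2 * R), Real.log (w z) with hc
  set f₁ : EuclideanSpace ℝ (Fin n) → ℝ := fun z => Real.exp (-c) * w z ^ (1 : ℝ) with hf₁
  set f₂ : EuclideanSpace ℝ (Fin n) → ℝ := fun z => Real.exp c * w z ^ (-1 : ℝ) with hf₂
  have hf₁pos : ∀ z, 0 < f₁ z := fun z => mul_pos (Real.exp_pos _) (Real.rpow_pos_of_pos (hpos z) _)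
  have hf₂pos : ∀ z, 0 < f₂ z := fun z => mul_pos (Real.exp_pos _) (Real.rpow_pos_of_pos (hpos z) _)
  have hlog₁ : ∀ z, Real.log (f₁ z) = Real.log (w z) - c := fun z => by
    show Real.log (Real.exp (-c) * w z ^ (1 : ℝ)) = _
    rw [Real.rpow_one, Real.log_mul (Real.exp_pos _).ne' (hpos z).ne', Real.log_exp]; ring
  have hlog₂ : ∀ z, Real.log (f₂ z) = c - Real.log (w z) := fun z => by
    show Real.log (Real.exp c * w z ^ (-1 : ℝ)) = _
    rw [Real.rpow_neg_one, Real.log_mul (Real.exp_pos _).ne' (inv_pos.2 (hpos z)).ne', Real.log_exp,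
      Real.log_inv]; ring
  have hcont : ∀ s : ℝ, Continuous fun z => w z ^ s := fun s => (contDiff_rpow_of_one_le hw hw1 s).continuous
  have hf₁m : Measurable f₁ := (continuous_const.mul (hcont 1)).measurable
  have hf₂m : Measurable f₂ := (continuous_const.mul (hcont (-1))).measurable
  -- qualitative bounds on `S 1` (compactness)
  have hbound : ∀ {f : EuclideanSpace ℝ (Fin n) → ℝ}, Continuous f → (∀ z, 0 < f z) →
      ∃ L : ℝ, ∀ z ∈ S 1, Real.log (f z) ≤ L := by
    intro f hf hfp
    obtain ⟨M, hM⟩ := (isCompact_closedBall x₀ (2 * 1 * R)).exists_bound_of_continuousOn hf.continuousOn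
    refine ⟨M, fun z hz => ?_⟩
    have h1 : Real.log (f z) ≤ f z := (Real.log_le_sub_one_of_pos (hfp z)).trans (by linarith)
    exact h1.trans ((le_abs_self _).trans ((Real.norm_eq_abs _).symm.le.trans (hM z hz)))
  obtain ⟨L₁, hL₁⟩ := hbound (continuous_const.mul (hcont 1)) hf₁pos
  obtain ⟨L₂, hL₂⟩ := hbound (continuous_const.mul (hcont (-1))) hf₂pos
  -- hypothesis (A) for both functions
  have hA : ∀ {f : EuclideanSpace ℝ (Fin n) → ℝ}, (∀ z, Real.log (f z) ≤ |Real.log (w z) - c|) →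
      ∀ t : ℝ, 0 < t → volume {z ∈ S 1 | t < Real.log (f z)} ≤ ENNReal.ofReal (C₀g / t) * volume (S 1) := by
    intro f hf t ht
    have h := local_log_levelset hsymm hlam hmeas hell hbd hw hw1 hweak hcutb x₀ hR hU hf ht
    rw [hS1]
    refine h.trans (mul_le_mul' (ENNReal.ofReal_le_ofReal ?_) le_rfl)
    exact div_le_div_of_nonneg_right (le_max_left _ _) ht.le
  have hA₁ := hA (f := f₁) (fun z => by rw [hlog₁]; exact le_abs_self _)
  have hA₂ := hA (f := f₂) (fun z => by rw [hlog₂, abs_sub_comm]; exact le_abs_self _)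
  -- hypothesis (B): sup side (`σ = 1`)
  have hB₁ : ∀ (θ' θ p : ℝ), 1 / 2 ≤ θ' → θ' < θ → θ ≤ 1 → 0 < p → p ≤ 1 → ∃ p' : ℝ, p / κ ≤ p' ∧ p' ≤ p ∧
      ∀ z ∈ S θ', ENNReal.ofReal (f₁ z ^ p') ≤
        ENNReal.ofReal (C₁ / (θ - θ') ^ (n : ℝ)) * (volume (S 1))⁻¹ * ∫⁻ y in S θ, ENNReal.ofReal (f₁ y ^ p') := by
    intro θ' θ p hθ' hθ'θ hθ hp _
    obtain ⟨p₁, hlo, hhi, hch⟩ := exists_chain_exponent_between hκ1 hp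
    have hp₁ : 0 < p₁ := lt_of_lt_of_le (div_pos hp hκ0) hlo
    refine ⟨p₁, hlo, hhi, fun z hz => ?_⟩
    have h := local_sup_bound hn hsymm hlam hmeas hell hbd hw hw1 hweak (σ := 1) (Or.inl rfl) hp₁ (D := D₁)
      (by positivity) (fun k => (hch k).1) (fun k => (hch k).2) hC₁cpos hcut' x₀ hR hU2 hθ' hθ'θ hθ
      (m := Real.exp (-c)) (Real.exp_pos _) z hz
    rw [hS1]
    refine h.trans (mul_le_mul' (mul_le_mul' (ENNReal.ofReal_le_ofReal
      (div_le_div_of_nonneg_right ?_ (Real.rpow_nonneg (by linarith) _))) le_rfl) le_rfl)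
    show C₁p ≤ C₁
    exact le_max_left _ _
  -- hypothesis (B): inf side (`σ = -1`; every exponent is admissible)
  have hB₂ : ∀ (θ' θ p : ℝ), 1 / 2 ≤ θ' → θ' < θ → θ ≤ 1 → 0 < p → p ≤ 1 → ∃ p' : ℝ, p / κ ≤ p' ∧ p' ≤ p ∧
      ∀ z ∈ S θ', ENNReal.ofReal (f₂ z ^ p') ≤
        ENNReal.ofReal (C₁ / (θ - θ') ^ (n : ℝ)) * (volume (S 1))⁻¹ * ∫⁻ y in S θ, ENNReal.ofReal (f₂ y ^ p') := by
    intro θ' θ p hθ' hθ'θ hθ hp _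
    refine ⟨p, div_le_self hp.le hκ1.le, le_rfl, fun z hz => ?_⟩
    have hne : ∀ k : ℕ, (-1 : ℝ) * (p * (n / (n - 2 : ℝ)) ^ k) ≠ 1 := fun k => by
      have : 0 < p * (n / (n - 2 : ℝ)) ^ k := by rw [← hκ]; positivity
      linarith
    have hD : ∀ k : ℕ, ((-1 : ℝ) * (p * (n / (n - 2 : ℝ)) ^ k) / ((-1 : ℝ) * (p * (n / (n - 2 : ℝ)) ^ k) - 1)) ^ 2 ≤ 1 := by
      intro k
      have hq : (-1 : ℝ) * (p * (n / (n - 2 : ℝ)) ^ k) < 0 := by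
        have : 0 < p * (n / (n - 2 : ℝ)) ^ k := by rw [← hκ]; positivity
        linarith
      set q : ℝ := -1 * (p * (n / (n - 2 : ℝ)) ^ k)
      have h1 : 0 < q / (q - 1) := div_pos_of_neg_of_neg hq (by linarith)
      have h2 : q / (q - 1) ≤ 1 := by rw [div_le_one_of_neg (by linarith)]; linarith
      nlinarith
    have h := local_sup_bound hn hsymm hlam hmeas hell hbd hw hw1 hweak (σ := -1) (Or.inr rfl) hp (D := 1)
      zero_le_one hne hD hC₁cpos hcut' x₀ hR hU2 hθ' hθ'θ hθ (m := Real.exp c) (Real.exp_pos _) z hz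
    rw [hS1]
    refine h.trans (mul_le_mul' (mul_le_mul' (ENNReal.ofReal_le_ofReal
      (div_le_div_of_nonneg_right ?_ (Real.rpow_nonneg (by linarith) _))) le_rfl) le_rfl)
    show C₁m ≤ C₁
    exact le_max_right _ _
  -- the lemma, twice
  have hγ : (0 : ℝ) < n := hnpos
  have hC₀p : 1 ≤ C₀g * 1 := by rw [mul_one]; exact le_max_right _ _
  have hxS : x ∈ S (1 / 2) := by rw [hShalf]; exact hx
  have hyS : y ∈ S (1 / 2) := by rw [hShalf]; exact hy
  have h₁ := bombieriGiusti (μ := volume) hS hSm hV0 hVt hf₁m (fun z _ => hf₁pos z) hL₁ hC₀gpos hC₀p hC₁1 hγ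
    hκ1.le hA₁ hB₁ x hxS
  have h₂ := bombieriGiusti (μ := volume) hS hSm hV0 hVt hf₂m (fun z _ => hf₂pos z) hL₂ hC₀gpos hC₀p hC₁1 hγ
    hκ1.le hA₂ hB₂ y hyS
  rw [hlog₁] at h₁
  rw [hlog₂] at h₂
  -- `log w x - log w y ≤ 2 A₀`
  have hxy : Real.log (w x) ≤ 2 * A₀ + Real.log (w y) := by rw [hA₀]; linarith
  calc w x = Real.exp (Real.log (w x)) := (Real.exp_log (hpos x)).symm
    _ ≤ Real.exp (2 * A₀ + Real.log (w y)) := Real.exp_le_exp.2 hxy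
    _ = Real.exp (2 * A₀) * w y := by rw [Real.exp_add, Real.exp_log (hpos y)]

end Summit.NavierStokesRegularity.NavierStokesRegularity.Theorems.PoloidalWindowDoorPoloidalWindowRigidityDivFormLocalHarnack

end
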